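import Summits.Ventures.LatticeQCDFlow.Exactness.HeatBathSweepErgodic
import HarnessLib

/-!
# The heat-bath sweep of a continuous action on a compact configuration space is uniformly ergodic — no hypothesis left

HONEST FRAMING: exact (Metropolis-corrected) sampling algorithms for lattice gauge theory;
figures of merit are autocorrelation/cost numbers at stated couplings and volumes; no
continuum-physics claim.

Venture `LatticeQCDFlow` (cell pub-lqcd), topic `Exactness`, FANOUT row 9 (eng-latcore, the
engine `latflow.core`).  NEW WORK of the cell: the engine-level corollary of
`Exactness/HeatBathSweepErgodic.lean` (row 9).  There the single-site heat-bath scan on a finite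
product of probability spaces was shown exact and, for a joint density pinched between two positive
constants `m ≤ p ≤ M`, uniformly ergodic with Doeblin constant `(m/M)^{|scan|}`.  Here the pinching
is DISCHARGED for the situation the engine is in: compact single-site spaces (SU(2), U(1) with Haar
probability), a CONTINUOUS action `S` (the Wilson action at any coupling on a finite lattice) and
the Gibbs density `p = e^{−S}`, which a continuous function on a compact space bounds above and
below.  Nothing is cited as a fact.  Printed counterpart, NAMED ONLY: Roberts–Polson 1994 (uniform
ergodicity of the Gibbs sampler for a density bounded away from `0` and `∞` on a compact support).

## What is proved

* `gibbsDensity S = e^{−S}` as an `ℝ≥0∞`-valued density; measurable for continuous `S`; pinched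
  between `e^{−sup S}` and `e^{−inf S}` (`gibbsDensity_bounds`).
* **`heatBathSweep_uniformlyErgodic_of_continuous`** — for a finite index type, compact
  second-countable Borel single-site spaces with probability reference laws, a continuous action
  `S` and any scan `l` visiting every site, there is an EXPLICIT `ε = e^{−(sup S − inf S)·|l|} ∈ (0, 1]`
  with `|μ₀Kᵗ(A) − π(A)| ≤ (1 − ε)ᵗ` for every initial law `μ₀`, every `t`, every set `A`
  (`K` = the heat-bath scan, `π = piGibbsLaw`, the normalised `e^{−S} · ⊗μ_i`); and the same after
  composing with any exact Markov kernel (`heatBathSweep_comp_uniformlyErgodic_of_continuous`: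
  over-relaxation sweeps).

For the engine (`X_i = SU(2)` or `U(1)`, `μ_i` = Haar probability, `S = β·S_W`): the U(1)/SU(2)
heat-bath (+ over-relaxation) stream of `latflow.core` converges to the Wilson law from every start
on every finite lattice at every `β`; the constant is qualitative (astronomically small), the
measured autocorrelation numbers remain the figures of merit.

NOT CLAIMED: SU(N ≥ 3) (Cabibbo–Marinari pseudo-heat-bath), HMC, non-compact fields, any useful
rate.
-/

namespace Summit.Ventures.LatticeQCDFlow.Exactness

open MeasureTheory ProbabilityTheory
open scoped ENNReal

section Compact

variable {ι : Type*} [Fintype ι] [DecidableEq ι] {X : ι → Type*} [∀ i, TopologicalSpace (X i)]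
  [∀ i, CompactSpace (X i)] [∀ i, SecondCountableTopology (X i)] [∀ i, MeasurableSpace (X i)]
  [∀ i, BorelSpace (X i)] {μ : Π i, Measure (X i)} [∀ i, IsProbabilityMeasure (μ i)]

/-- The Gibbs density `e^{−S}` of an action `S`, `ℝ≥0∞`-valued. -/
noncomputable def gibbsDensity (S : (Π j, X j) → ℝ) (ω : Π j, X j) : ℝ≥0∞ :=
  ENNReal.ofReal (Real.exp (-S ω))

omit [DecidableEq ι] [∀ i, CompactSpace (X i)] in
/-- The Gibbs density of a continuous action is measurable. -/
theorem measurable_gibbsDensity {S : (Π j, X j) → ℝ} (hS : Continuous S) : Measurable (gibbsDensity S) :=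
  (Real.measurable_exp.comp hS.measurable.neg).ennreal_ofReal

omit [Fintype ι] [DecidableEq ι] [∀ i, TopologicalSpace (X i)] [∀ i, CompactSpace (X i)]
  [∀ i, SecondCountableTopology (X i)] [∀ i, MeasurableSpace (X i)] [∀ i, BorelSpace (X i)] in
/-- Bounds `a ≤ S ≤ b` pinch the Gibbs density: `e^{−b} ≤ e^{−S} ≤ e^{−a}`. -/
theorem gibbsDensity_bounds {S : (Π j, X j) → ℝ} {a b : ℝ} (ha : ∀ ω, a ≤ S ω) (hb : ∀ ω, S ω ≤ b)
    (ω : Π j, X j) :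
    ENNReal.ofReal (Real.exp (-b)) ≤ gibbsDensity S ω ∧ gibbsDensity S ω ≤ ENNReal.ofReal (Real.exp (-a)) :=
  ⟨ENNReal.ofReal_le_ofReal (Real.exp_le_exp.2 (neg_le_neg (hb ω))),
    ENNReal.ofReal_le_ofReal (Real.exp_le_exp.2 (neg_le_neg (ha ω)))⟩

/-- **Uniform ergodicity of the heat-bath sweep of a continuous action on a compact configuration
space.**  With `ε = e^{−(b − a)|l|}` for any bounds `a ≤ S ≤ b` (which exist by compactness): for
every scan `l` visiting every site, every initial law, every `t`, every set,
`|μ₀Kᵗ(A) − π(A)| ≤ (1 − ε)ᵗ`. -/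
theorem heatBathSweep_uniformlyErgodic_of_continuous {S : (Π j, X j) → ℝ} (hS : Continuous S)
    {l : List ι} (hl : ∀ i, i ∈ l) :
    ∃ ε : ℝ, 0 < ε ∧ ε ≤ 1 ∧ ∀ (μ₀ : Measure (Π j, X j)) [IsProbabilityMeasure μ₀] (t : ℕ) (A : Set (Π j, X j)),
      |((fun ν : Measure (Π j, X j) => ν.bind (cycle (l.map (siteHeatBath μ (gibbsDensity S)))))^[t] μ₀).real A
          - (piGibbsLaw μ (gibbsDensity S)).real A| ≤ (1 - ε) ^ t := by
  rcases isEmpty_or_nonempty (Π j, X j) with hE | hne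
  · refine ⟨1, one_pos, le_rfl, fun μ₀ _ t A => ?_⟩
    exact absurd (measure_univ (μ := μ₀)) (by rw [Set.univ_eq_empty_iff.2 hE, measure_empty]; exact zero_ne_one)
  obtain ⟨ωa, -, hmin⟩ := isCompact_univ.exists_isMinOn Set.univ_nonempty hS.continuousOn
  obtain ⟨ωb, -, hmax⟩ := isCompact_univ.exists_isMaxOn Set.univ_nonempty hS.continuousOn
  have hωa : ∀ ω, S ωa ≤ S ω := fun ω => (isMinOn_iff.1 hmin) ω (Set.mem_univ ω)
  have hωb : ∀ ω, S ω ≤ S ωb := fun ω => (isMaxOn_iff.1 hmax) ω (Set.mem_univ ω)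
  set a := S ωa
  set b := S ωb
  have hab : a ≤ b := hωa ωb
  refine ⟨(Real.exp (-b) / Real.exp (-a)) ^ l.length, by positivity, ?_, fun μ₀ _ t A => ?_⟩
  · exact pow_le_one₀ (by positivity) ((div_le_one (Real.exp_pos _)).2 (Real.exp_le_exp.2 (neg_le_neg hab)))
  · have h := heatBathSweep_uniformlyErgodic (μ := μ) (p := gibbsDensity S) (measurable_gibbsDensity hS)
      (m := ENNReal.ofReal (Real.exp (-b))) (M := ENNReal.ofReal (Real.exp (-a)))
      (by rw [Ne, ENNReal.ofReal_eq_zero, not_le]; exact Real.exp_pos _) ENNReal.ofReal_ne_top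
      (fun ω => (gibbsDensity_bounds hωa hωb ω).1) (fun ω => (gibbsDensity_bounds hωa hωb ω).2) hl μ₀ t A
    rwa [ENNReal.toReal_ofReal (Real.exp_pos _).le, ENNReal.toReal_ofReal (Real.exp_pos _).le] at h

/-- **… and after any exact update** (over-relaxation sweeps): the same `ε` works for `η ∘ₖ K` with
any Markov `η` leaving `e^{−S} · ⊗μ_i` invariant. -/
theorem heatBathSweep_comp_uniformlyErgodic_of_continuous {S : (Π j, X j) → ℝ} (hS : Continuous S)
    {l : List ι} (hl : ∀ i, i ∈ l) (η : Kernel (Π j, X j) (Π j, X j)) [IsMarkovKernel η]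
    (hη : Kernel.Invariant η ((Measure.pi μ).withDensity (gibbsDensity S))) :
    ∃ ε : ℝ, 0 < ε ∧ ε ≤ 1 ∧ ∀ (μ₀ : Measure (Π j, X j)) [IsProbabilityMeasure μ₀] (t : ℕ) (A : Set (Π j, X j)),
      |((fun ν : Measure (Π j, X j) =>
          ν.bind (η ∘ₖ cycle (l.map (siteHeatBath μ (gibbsDensity S)))))^[t] μ₀).real A
          - (piGibbsLaw μ (gibbsDensity S)).real A| ≤ (1 - ε) ^ t := by
  rcases isEmpty_or_nonempty (Π j, X j) with hE | hne
  · refine ⟨1, one_pos, le_rfl, fun μ₀ _ t A => ?_⟩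
    exact absurd (measure_univ (μ := μ₀)) (by rw [Set.univ_eq_empty_iff.2 hE, measure_empty]; exact zero_ne_one)
  obtain ⟨ωa, -, hmin⟩ := isCompact_univ.exists_isMinOn Set.univ_nonempty hS.continuousOn
  obtain ⟨ωb, -, hmax⟩ := isCompact_univ.exists_isMaxOn Set.univ_nonempty hS.continuousOn
  have hωa : ∀ ω, S ωa ≤ S ω := fun ω => (isMinOn_iff.1 hmin) ω (Set.mem_univ ω)
  have hωb : ∀ ω, S ω ≤ S ωb := fun ω => (isMaxOn_iff.1 hmax) ω (Set.mem_univ ω)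
  set a := S ωa
  set b := S ωb
  have hab : a ≤ b := hωa ωb
  refine ⟨(Real.exp (-b) / Real.exp (-a)) ^ l.length, by positivity, ?_, fun μ₀ _ t A => ?_⟩
  · exact pow_le_one₀ (by positivity) ((div_le_one (Real.exp_pos _)).2 (Real.exp_le_exp.2 (neg_le_neg hab)))
  · have h := heatBathSweep_comp_uniformlyErgodic (μ := μ) (p := gibbsDensity S) (measurable_gibbsDensity hS)
      (m := ENNReal.ofReal (Real.exp (-b))) (M := ENNReal.ofReal (Real.exp (-a)))
      (by rw [Ne, ENNReal.ofReal_eq_zero, not_le]; exact Real.exp_pos _) ENNReal.ofReal_ne_top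
      (fun ω => (gibbsDensity_bounds hωa hωb ω).1) (fun ω => (gibbsDensity_bounds hωa hωb ω).2) hl η hη μ₀ t A
    rwa [ENNReal.toReal_ofReal (Real.exp_pos _).le, ENNReal.toReal_ofReal (Real.exp_pos _).le] at h

end Compact

end Summit.Ventures.LatticeQCDFlow.Exactness
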